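import Literature.NumberTheory.Sieve.AsymptoticSieveForPrimesTyz
import Literature.NumberTheory.Sieve.AsymptoticSieveForPrimesS1
import Literature.NumberTheory.Sieve.AsymptoticSieveForPrimesS2
import Literature.NumberTheory.Sieve.AsymptoticSieveForPrimesBrun
import Literature.NumberTheory.Sieve.AsymptoticSieveForPrimesDecompositionProofs
import HarnessLib

/-!
# Asymptotic sieve for primes: Theorem 1 from the two deep inputs and the two open estimates

Trunk T-SIEVE. Source: J. Friedlander, H. Iwaniec, *Asymptotic sieve for primes*, Ann. of Math. 148
(1998) 1041–1065 [FriedlanderIwaniecASP1998], §8 p. 1058: "Combining (3.4), (3.5), (4.5), (5.1),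
(6.6), (7.2) and (8.5) we complete the proof of Theorem 1."

This file records the state of the discharge of `Literature.NumberTheory.Sieve.fi_asymptotic_sieve_primes_loglog`: of the
eight inputs of `Literature.NumberTheory.Sieve.fi_asymptotic_sieve_primes_loglog_of_estimates` (`…Assembly`), five are now
theorems of the tree — Brun's weights (`brun_upperSieveWeights_holds`, `…Brun`), the sieve-density
class (`fi_sieve_density_admissible_holds`) and `H > 0` (`fi_densityConstant_pos_holds`,
`…DecompositionProofs`), (6.6) (`fi_asp_S1_estimate_holds`, `…S1`) and (7.2)
(`fi_asp_S2_estimate_holds`, `…S2`) — and (5.1) is reduced to FI (2.4)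
(`fi_asp_Tyz_estimate_of_cancellation`, `…Tyz`). What remains: the named fact (2.4)
(`fi_moebius_density_cancellation`) and the estimates (4.5) (`fi_asp_T_estimate`, which needs (2.4)
and (1.13)–(1.14)) and (8.5) (`fi_asp_S3_estimate`, which needs (2.4), (R′), (B′)).

## Mathlib search

Nothing to search: a composition of theorems of this series.
-/

namespace Literature.NumberTheory.Sieve

/-- **FI Theorem 1 (log log form) from (2.4), (4.5) and (8.5).** The asymptotic sieve for primes
`fi_asymptotic_sieve_primes_loglog` follows from the Möbius–density cancellation (2.4), the
evaluation (4.5) of `T(x; Y)` and the estimate (8.5) of `S₃(x; Y, Z)`; everything else in FI's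
proof (Brun's sieve, (3.4)–(3.5), (5.1), (6.6), (7.2), `H > 0`) is proved in the tree.
[cite: FriedlanderIwaniecASP1998, §8 p. 1058 (proof of Theorem 1)] -/
theorem fi_asymptotic_sieve_primes_loglog_of_inputs (h24 : fi_moebius_density_cancellation)
    (hT : fi_asp_T_estimate) (hS3 : fi_asp_S3_estimate) : fi_asymptotic_sieve_primes_loglog :=
  fi_asymptotic_sieve_primes_loglog_of_estimates brun_upperSieveWeights_holds
    fi_sieve_density_admissible_holds fi_densityConstant_pos_holds hT
    (fi_asp_Tyz_estimate_of_cancellation h24) fi_asp_S1_estimate_holds fi_asp_S2_estimate_holds hS3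

end Literature.NumberTheory.Sieve
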